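import Mathlib

/-!
# The family wall `Σ_i |X_i||Y_i| ≤ dim J` — split-mono certificate proof

Route `LevelGradedCohnUmans`, crux `GradedDesignFamily` (stmt-MatrixMultiplication-7610), registered
stub `familyWall_card_le_finrank` (siege k24, variation "certificate on the finite core").

The finite core is packaged as a **split monomorphism**.  Given a subspace `W ≤ R^α`, vectors
`w t ∈ W` and coordinates `p s : α` (`s, t : S`) whose evaluation matrix `(w t (p s))_{s,t}` is the
identity, the synthesis map `Ψ : R^S → W`, `c ↦ Σ_t c_t • w_t`, and the evaluation map
`ev : W → R^S`, `f ↦ (f (p s))_s`, satisfy `ev ∘ Ψ = id` — the identity matrix IS the certificate.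
Hence `Ψ` is injective and `|S| = dim R^S ≤ dim W` (`card_le_finrank_of_splitMono_certificate`);
no linear-independence bookkeeping is needed.

For a right-translation-invariant `J ≤ ℂ^G` and a family `(X_i, Y_i, Z_i)_i`, all `Z_i ≠ ∅`,
simultaneously `J`-separated in the crux's 0/1 pattern, the certificate is indexed by
`S = Σ_i X_i × Y_i`: `w_(i,x₀,y₀) = (g ↦ f_{i,x₀,z_i}(g · y₀⁻¹ z_i))` (right translate of the
separator of block `i`, one anchor `z_i ∈ Z_i` per block) and `p_(j,x,y) = x⁻¹ y`; the entry
`w_(i,x₀,y₀)(p_(j,x,y)) = f_{i,x₀,z_i}(x⁻¹ y y₀⁻¹ z_i)` is a value of the separator at a mixed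
quadruple product, `1` on the diagonal and `0` off it by simultaneity.  So
`Σ_i |X_i||Y_i| = |S| ≤ dim J` (`familyWall_card_le_finrank`).
[cite: CohnKleinbergSzegedyUmans2005, Def. 5.1]
-/

noncomputable section

-- the problem namespace `Summit.MatrixMultiplication.MatrixMultiplication` repeats a component
set_option linter.dupNamespace false

open scoped BigOperators
open Module

namespace Summit.MatrixMultiplication.MatrixMultiplication.Theorems.GradedDesignFamily.WallSplitMonoK24

/-- **Split-mono certificate.**  If `W ≤ R^α` contains vectors `w t` (`t : S`) and `p : S → α` are
coordinates with `w s (p s) = 1` and `w t (p s) = 0` for `s ≠ t`, then `|S| ≤ dim W`: evaluation at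
the points `p s` is a left inverse of the synthesis map `c ↦ Σ_t c_t • w_t : R^S → W`, which is
therefore injective. [folklore] -/
theorem card_le_finrank_of_splitMono_certificate {R α S : Type*} [Field R] [Finite α] [Fintype S]
    (W : Submodule R (α → R)) (w : S → (α → R)) (hw : ∀ t, w t ∈ W) (p : S → α)
    (hdiag : ∀ s, w s (p s) = 1) (hoff : ∀ s t, s ≠ t → w t (p s) = 0) :
    Fintype.card S ≤ finrank R W := by
  -- synthesis map `c ↦ Σ_t c_t • w_t ∈ W`
  let Ψ : (S → R) →ₗ[R] W := Fintype.linearCombination R fun t => (⟨w t, hw t⟩ : W)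
  -- evaluation map `f ↦ (f (p s))_s`
  let ev : W →ₗ[R] (S → R) := LinearMap.pi fun s => (LinearMap.proj (p s)).comp W.subtype
  -- the certificate: `ev ∘ Ψ = id`
  have hcert : Function.LeftInverse ev Ψ := by
    intro c
    funext s
    show ((Ψ c : W) : α → R) (p s) = c s
    simp only [Ψ, Fintype.linearCombination_apply, Submodule.coe_sum, Submodule.coe_smul,
      Finset.sum_apply, Pi.smul_apply, smul_eq_mul]
    rw [Finset.sum_eq_single s (fun t _ hts => by rw [hoff s t (Ne.symm hts), mul_zero])
      (fun h => absurd (Finset.mem_univ s) h), hdiag, mul_one]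
  calc Fintype.card S = finrank R (S → R) := (finrank_fintype_fun_eq_card R).symm
    _ ≤ finrank R W := LinearMap.finrank_le_finrank_of_injective hcert.injective

/-- **The family wall** (registered stub `familyWall_card_le_finrank` of crux
`GradedDesignFamily`, verbatim).  If `J ≤ ℂ^G` is right-translation invariant and the family
`(X_i, Y_i, Z_i)_{i : ι}` with all `Z_i` non-empty is simultaneously `J`-separated, then
`Σ_i |X_i|·|Y_i| ≤ dim J`.  Proof: the split-mono certificate
`card_le_finrank_of_splitMono_certificate` with vectors the right translates
`g ↦ f_{i,x₀,z_i}(g · y₀⁻¹ z_i)` of the separators and coordinates `x⁻¹ y`.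
[cite: CohnKleinbergSzegedyUmans2005, Def. 5.1] -/
theorem familyWall_card_le_finrank {G : Type} [Group G] [Fintype G] {ι : Type} [Fintype ι]
    [DecidableEq ι] (J : Submodule ℂ (G → ℂ)) (hJ : ∀ f ∈ J, ∀ u : G, (fun g : G => f (g * u)) ∈ J)
    (X Y Z : ι → Finset G) (hZ : ∀ i, (Z i).Nonempty)
    (hsep : ∀ i : ι, ∀ x₀ ∈ X i, ∀ z₀ ∈ Z i, ∃ f ∈ J, ∀ a b : ι, ∀ x ∈ X a, ∀ y ∈ Y a, ∀ y' ∈ Y b,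
      ∀ z ∈ Z b, ((a = i ∧ b = i ∧ x = x₀ ∧ y = y' ∧ z = z₀) → f (x⁻¹ * y * y'⁻¹ * z) = 1) ∧
        (¬ (a = i ∧ b = i ∧ x = x₀ ∧ y = y' ∧ z = z₀) → f (x⁻¹ * y * y'⁻¹ * z) = 0)) :
    ∑ i, (X i).card * (Y i).card ≤ finrank ℂ J := by
  classical
  -- one anchor `zc i ∈ Z i` per block, and the separators `F i x₀ _ z₀ _` of the family
  choose zc hzc using hZ
  choose F hFJ hF using hsep
  -- index set of the certificate: pairs `(x, y) ∈ X_i × Y_i` over all blocks `i`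
  let S : Type := Σ i : ι, ↥(X i) × ↥(Y i)
  -- certificate vectors (right translates of the anchored separators) and coordinates
  let w : S → (G → ℂ) := fun t g =>
    F t.1 t.2.1 t.2.1.2 (zc t.1) (hzc t.1) (g * ((t.2.2 : G)⁻¹ * zc t.1))
  let p : S → G := fun s => (s.2.1 : G)⁻¹ * s.2.2
  have hw : ∀ t, w t ∈ J := fun t => hJ _ (hFJ t.1 t.2.1 t.2.1.2 (zc t.1) (hzc t.1)) _
  -- diagonal entries are `1`
  have hdiag : ∀ s, w s (p s) = 1 := by
    rintro ⟨i, ⟨x, hx⟩, ⟨y, hy⟩⟩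
    show F i x hx (zc i) (hzc i) (x⁻¹ * y * (y⁻¹ * zc i)) = 1
    rw [← mul_assoc]
    exact (hF i x hx (zc i) (hzc i) i i x hx y hy y hy (zc i) (hzc i)).1 ⟨rfl, rfl, rfl, rfl, rfl⟩
  -- off-diagonal entries are `0` (cross-block entries by simultaneity)
  have hoff : ∀ s t, s ≠ t → w t (p s) = 0 := by
    rintro ⟨a, ⟨x, hx⟩, ⟨y, hy⟩⟩ ⟨b, ⟨x₀, hx₀⟩, ⟨y₀, hy₀⟩⟩ hst
    show F b x₀ hx₀ (zc b) (hzc b) (x⁻¹ * y * (y₀⁻¹ * zc b)) = 0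
    rw [← mul_assoc]
    refine (hF b x₀ hx₀ (zc b) (hzc b) a b x hx y hy y₀ hy₀ (zc b) (hzc b)).2 ?_
    rintro ⟨rfl, -, rfl, rfl, -⟩
    exact hst rfl
  -- counting the index set
  have hcard : Fintype.card S = ∑ i, (X i).card * (Y i).card := by
    simp only [S, Fintype.card_sigma, Fintype.card_prod, Fintype.card_coe]
  rw [← hcard]
  exact card_le_finrank_of_splitMono_certificate J w hw p hdiag hoff

end Summit.MatrixMultiplication.MatrixMultiplication.Theorems.GradedDesignFamily.WallSplitMonoK24

end
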